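import Summits.RiemannHypothesis.RiemannHypothesis.Theorems.PfPersistenceDilationProfile
import Summits.RiemannHypothesis.RiemannHypothesis.Theorems.PfPersistenceDownCone
import HarnessLib

/-!
# The closed Weil form of an ARBITRARY real weight table (pub-rhpf, theory-1 gen 5; helper for
# crux `EvenSectorBarta.EvenOneSignedWindows`, item stmt-RiemannHypothesis-19953; RH-free)

**mechanism/rigidity campaign; no RH claims.**  Companion text:
`run/shared/lean/pub/pub-rhpf/pub-rhpf-theory-1/THEORY-EDGE-5.md`; the edge law and the dial
lemma built on this file are in `PfPersistenceEdgeLawDialSpace`.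

A real weight table `w : ℕ → ℝ` is the continuum datum `tableDatum w` of `PfPersistenceDownCone`
(masses `w n` at `± log n`, ζ's polar + archimedean dressing); every point of the campaign's
`dialSpace` / `arithDialSpace` (reweightings, deletions, one- and two-sided `p`-dials,
`λ`-perturbations, sign twists) is the Galerkin discretisation of one.  This file is the (O1)
bookkeeping of adjudication A79 ("per-family instantiation routine, not landed") for all of them at
once (PROVED, every statement below):

* `tableClosedForm a w f = P(f) + 𝓔^w_a(f) − M^w_a ‖f‖²` (Bombieri's shape) with
  `𝓔^w_a(f) = Σ_{log n < 2a} w(n) D_{log n}(f) + ∫ ρ D(f)` (`tableDirichletEnergy`) and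
  `M^w_a = 2 Σ_{log n < 2a} w(n) + (ζ's archimedean killing constant)` (`tableMarkovConstant`);
  `tableClosedForm_zetaTable`: ζ's table `Λ(n)/√n` gives back `weilClosedForm` (by `rfl`).
* `tableClosedForm_sub` / `tableClosedForm_eq_weilClosedForm_add`:
  `form_w − form_{w'} = Σ_{log n < 2a} (w n − w' n)(D_{log n} f − 2‖f‖²)`.
* `weilIncrement_le_four_mul_of_memLp` (`0 ≤ D_t(f) ≤ 4‖f‖²` on `L²`) ⇒
  `abs_tableClosedForm_sub_le`: `|form_w(f) − form_{w'}(f)| ≤ 2‖f‖² · tableDist a w w'`,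
  `tableDist a w w' = Σ_{log n < 2a} |w n − w' n|` — the closed form is Lipschitz in the table.
* `tableClosedForm_window`: reference-window independence (`b ≤ B`, `f ∈ L²`, `f = 0` off
  `(-b, b)`), from the tree's `stub_localizedCut_*` for ζ plus `D_{log n} f = 2‖f‖²` beyond `2b`.
* `tableDatum_primeTerm_weilConv_weilReflect`, `tableClosedForm_eq_re_quadratic`: on test functions
  supported in `[-a, a]` the closed form IS `Re Q_{tableDatum w}` (ζ's case is the tree's
  `weilClosedForm_eq_re_weilQuadratic`).

References: E. Bombieri, Rend. Mat. Acc. Lincei (9) 11 (2000) 183–233, Thm 2 (p. 193);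
the tree files `Literature/NumberTheory/LFunctions/WeilMarkovQuadratic.lean`,
`Theorems/PfPersistenceDilationProfile.lean`, `Theorems/PfPersistenceDownCone.lean`.
-/

set_option linter.dupNamespace false

noncomputable section

open MeasureTheory Set Filter
open scoped Topology ArithmeticFunction.vonMangoldt

namespace Summit.RiemannHypothesis.RiemannHypothesis.Theorems.PfPersistence

open Literature.NumberTheory.LFunctions
open Summit.RiemannHypothesis.RiemannHypothesis.Theorems.WeilWindowFlowWindowLipschitz
  (stub_localizedCut_energy_window stub_localizedCut_weilIncrement_eq_two_mul)
open Summit.RiemannHypothesis.RiemannHypothesis.Theorems.PfPersistenceDownCone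
  (zetaTable tableDatum tableDatum_smooth tableDatum_zetaTable_quadratic)
open Summit.RiemannHypothesis.RiemannHypothesis.Theorems.PfPersistenceBarrier

/-! ## §1 The closed form of a real weight table -/

/-- The pure-jump energy form of the table `w` at the window `a`:
`𝓔^w_a(f) = Σ_{log n < 2a} w(n) D_{log n}(f) + ∫₀^∞ ρ(t) D_t(f) dt` (ζ: `w = Λ(n)/√n`,
`weilDirichletEnergy`). [cite: Bombieri2000Weil, Thm 2 (p. 193)] -/
def tableDirichletEnergy (a : ℝ) (w : ℕ → ℝ) (f : ℝ → ℂ) : ℝ :=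
  (∑ n ∈ weilPrimeIndex a, w n * weilIncrement f (Real.log n)) +
    ∫ t in Ioi (0 : ℝ), weilArchDensity t * weilIncrement f t

/-- The killing constant of the table `w` at the window `a`:
`M^w_a = 2 Σ_{log n < 2a} w(n) + 2∫₀^∞ (e^{t/2} − 1)/(2 sinh t) dt + log 4π + γ`. [cite: Bombieri2000Weil, Thm 2 (p. 193)] -/
def tableMarkovConstant (a : ℝ) (w : ℕ → ℝ) : ℝ :=
  2 * (∑ n ∈ weilPrimeIndex a, w n) +
    2 * (∫ t in Ioi (0 : ℝ), (Real.exp (t / 2) - 1) / (2 * Real.sinh t)) +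
    (Real.log (4 * Real.pi) + Real.eulerMascheroniConstant)

/-- **The closed form of the table `w` read at the window `[-a, a]`**:
`P(f) + 𝓔^w_a(f) − M^w_a ‖f‖²` (Bombieri's shape; `= Re Q_{tableDatum w}(f)` on window tests,
`tableClosedForm_eq_re_quadratic`). [cite: Bombieri2000Weil, Thm 2 (p. 193)] -/
def tableClosedForm (a : ℝ) (w : ℕ → ℝ) (f : ℝ → ℂ) : ℝ :=
  weilPoleForm f + tableDirichletEnergy a w f - tableMarkovConstant a w * ∫ x, ‖f x‖ ^ 2

/-- The `ℓ¹` distance of two tables on the prime index of the window `a` (`log n < 2a`). [folklore] -/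
def tableDist (a : ℝ) (w w' : ℕ → ℝ) : ℝ :=
  ∑ n ∈ weilPrimeIndex a, |w n - w' n|

/-- `tableDist` is nonnegative. [folklore] -/
theorem tableDist_nonneg (a : ℝ) (w w' : ℕ → ℝ) : 0 ≤ tableDist a w w' :=
  Finset.sum_nonneg fun _ _ ↦ abs_nonneg _

/-- `tableDist` is symmetric. [folklore] -/
theorem tableDist_comm (a : ℝ) (w w' : ℕ → ℝ) : tableDist a w w' = tableDist a w' w :=
  Finset.sum_congr rfl fun _ _ ↦ abs_sub_comm _ _

/-- `tableDist a w w = 0`. [folklore] -/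
theorem tableDist_self (a : ℝ) (w : ℕ → ℝ) : tableDist a w w = 0 :=
  Finset.sum_eq_zero fun _ _ ↦ by rw [sub_self, abs_zero]

/-- Tables agreeing on the prime index of the window are at distance `0`. [folklore] -/
theorem tableDist_eq_zero_of_agree {a : ℝ} {w w' : ℕ → ℝ}
    (h : ∀ n : ℕ, Real.log n < 2 * a → w n = w' n) : tableDist a w w' = 0 :=
  Finset.sum_eq_zero fun n hn ↦ by rw [h n (mem_weilPrimeIndex.1 hn), sub_self, abs_zero]

/-- Finite-sum algebra: `Σ (uₙ − vₙ)(Dₙ − c) = Σ uₙDₙ − Σ vₙDₙ − c(Σ uₙ − Σ vₙ)`. [folklore] -/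
theorem sum_sub_mul_sub (s : Finset ℕ) (u v D : ℕ → ℝ) (c : ℝ) :
    ∑ n ∈ s, (u n - v n) * (D n - c) =
      (∑ n ∈ s, u n * D n) - (∑ n ∈ s, v n * D n) -
        c * ((∑ n ∈ s, u n) - ∑ n ∈ s, v n) := by
  classical
  refine Finset.induction_on s (by simp) ?_
  intro a s ha ih
  rw [Finset.sum_insert ha, Finset.sum_insert ha, Finset.sum_insert ha, Finset.sum_insert ha,
    Finset.sum_insert ha, ih]
  ring

/-- **Difference of the closed forms of two tables**:
`form_w(f) − form_{w'}(f) = Σ_{log n < 2a} (w n − w' n)(D_{log n}(f) − 2‖f‖²)`. [folklore] -/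
theorem tableClosedForm_sub (a : ℝ) (w w' : ℕ → ℝ) (f : ℝ → ℂ) :
    tableClosedForm a w f - tableClosedForm a w' f =
      ∑ n ∈ weilPrimeIndex a, (w n - w' n) *
        (weilIncrement f (Real.log n) - 2 * ∫ x, ‖f x‖ ^ 2) := by
  rw [sum_sub_mul_sub]
  unfold tableClosedForm tableDirichletEnergy tableMarkovConstant
  ring

/-- ζ's table has ζ's energy form. [folklore] -/
theorem tableDirichletEnergy_zetaTable (a : ℝ) (f : ℝ → ℂ) :
    tableDirichletEnergy a zetaTable f = weilDirichletEnergy a f := rfl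

/-- ζ's table has ζ's killing constant. [folklore] -/
theorem tableMarkovConstant_zetaTable (a : ℝ) :
    tableMarkovConstant a zetaTable = weilMarkovConstant a := rfl

/-- **ζ's table gives back the tree's closed Weil form.** [cite: Bombieri2000Weil, Thm 2 (p. 193)] -/
theorem tableClosedForm_zetaTable (a : ℝ) (f : ℝ → ℂ) :
    tableClosedForm a zetaTable f = weilClosedForm a f := rfl

/-- The closed form of a table as a perturbation of ζ's:
`form_w(f) = weilClosedForm a f + Σ_{log n < 2a} (w n − Λ(n)/√n)(D_{log n}(f) − 2‖f‖²)`. [folklore] -/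
theorem tableClosedForm_eq_weilClosedForm_add (a : ℝ) (w : ℕ → ℝ) (f : ℝ → ℂ) :
    tableClosedForm a w f = weilClosedForm a f +
      ∑ n ∈ weilPrimeIndex a, (w n - zetaTable n) *
        (weilIncrement f (Real.log n) - 2 * ∫ x, ‖f x‖ ^ 2) := by
  rw [← tableClosedForm_zetaTable, ← tableClosedForm_sub]
  ring

/-- `D_t(f) ≤ 4‖f‖₂²` for every `f ∈ L²` (`|u − v|² ≤ 2|u|² + 2|v|²`, translation invariance).
[folklore] -/
theorem weilIncrement_le_four_mul_of_memLp {f : ℝ → ℂ} (hf : MemLp f 2) (t : ℝ) :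
    weilIncrement f t ≤ 4 * ∫ x : ℝ, ‖f x‖ ^ 2 := by
  have h2 : Integrable fun u : ℝ ↦ ‖f u‖ ^ 2 := (memLp_two_iff_integrable_sq_norm hf.1).1 hf
  have h2' : Integrable fun u : ℝ ↦ ‖f (u + t)‖ ^ 2 := h2.comp_add_right t
  unfold weilIncrement
  calc ∫ x : ℝ, ‖f (x + t) - f x‖ ^ 2
      ≤ ∫ x : ℝ, (2 * ‖f (x + t)‖ ^ 2 + 2 * ‖f x‖ ^ 2) := by
        refine integral_mono_of_nonneg (Eventually.of_forall fun _ ↦ by positivity)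
          ((h2'.const_mul 2).add (h2.const_mul 2)) (Eventually.of_forall fun x ↦ ?_)
        have h := norm_sub_le (f (x + t)) (f x)
        have h' := mul_self_le_mul_self (norm_nonneg _) h
        nlinarith [h', sq_nonneg (‖f (x + t)‖ - ‖f x‖)]
    _ = 4 * ∫ x : ℝ, ‖f x‖ ^ 2 := by
        rw [integral_add (h2'.const_mul 2) (h2.const_mul 2), integral_const_mul,
          integral_const_mul, integral_add_right_eq_self (fun u : ℝ ↦ ‖f u‖ ^ 2) t]
        ring

/-- `|D_t(f) − 2‖f‖²| ≤ 2‖f‖²` for `f ∈ L²`. [folklore] -/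
theorem abs_weilIncrement_sub_two_mul_le {f : ℝ → ℂ} (hf : MemLp f 2) (t : ℝ) :
    |weilIncrement f t - 2 * ∫ x : ℝ, ‖f x‖ ^ 2| ≤ 2 * ∫ x : ℝ, ‖f x‖ ^ 2 := by
  have h0 := weilIncrement_nonneg f t
  have h4 := weilIncrement_le_four_mul_of_memLp hf t
  rw [abs_le]
  constructor <;> linarith

/-- The table correction is bounded: `|Σ uₙ (D_{log n} f − 2‖f‖²)| ≤ 2‖f‖² Σ |uₙ|`. [folklore] -/
theorem abs_sum_mul_weilIncrement_sub_le {f : ℝ → ℂ} (hf : MemLp f 2) (a : ℝ) (u : ℕ → ℝ) :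
    |∑ n ∈ weilPrimeIndex a, u n * (weilIncrement f (Real.log n) - 2 * ∫ x, ‖f x‖ ^ 2)| ≤
      2 * (∫ x : ℝ, ‖f x‖ ^ 2) * ∑ n ∈ weilPrimeIndex a, |u n| := by
  calc |∑ n ∈ weilPrimeIndex a, u n * (weilIncrement f (Real.log n) - 2 * ∫ x, ‖f x‖ ^ 2)|
      ≤ ∑ n ∈ weilPrimeIndex a, |u n * (weilIncrement f (Real.log n) - 2 * ∫ x, ‖f x‖ ^ 2)| :=
        Finset.abs_sum_le_sum_abs _ _
    _ ≤ ∑ n ∈ weilPrimeIndex a, |u n| * (2 * ∫ x : ℝ, ‖f x‖ ^ 2) := by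
        refine Finset.sum_le_sum fun n _ ↦ ?_
        rw [abs_mul]
        exact mul_le_mul_of_nonneg_left (abs_weilIncrement_sub_two_mul_le hf _) (abs_nonneg _)
    _ = 2 * (∫ x : ℝ, ‖f x‖ ^ 2) * ∑ n ∈ weilPrimeIndex a, |u n| := by
        rw [← Finset.sum_mul]
        ring

/-- **The closed form is `2‖f‖²`-Lipschitz in the table**:
`|form_w(f) − form_{w'}(f)| ≤ 2‖f‖² · Σ_{log n < 2a} |w n − w' n|` for `f ∈ L²`. [folklore] -/
theorem abs_tableClosedForm_sub_le {f : ℝ → ℂ} (hf : MemLp f 2) (a : ℝ) (w w' : ℕ → ℝ) :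
    |tableClosedForm a w f - tableClosedForm a w' f| ≤
      2 * (∫ x : ℝ, ‖f x‖ ^ 2) * tableDist a w w' := by
  rw [tableClosedForm_sub]
  exact abs_sum_mul_weilIncrement_sub_le hf a _

/-- **Window change for tables**: for `f ∈ L²` vanishing at every `|x| ≥ b` and `b ≤ B`, the
closed form read at `B` equals the closed form read at `b` (for `2b ≤ log n < 2B` the increment
`D_{log n}(f) = 2‖f‖²` kills the extra terms). [folklore] -/
theorem tableClosedForm_window {f : ℝ → ℂ} {b B : ℝ} (w : ℕ → ℝ) (hf : MemLp f 2) (hbB : b ≤ B)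
    (hsupp : ∀ x, b ≤ |x| → f x = 0) : tableClosedForm B w f = tableClosedForm b w f := by
  have hζ : weilClosedForm B f = weilClosedForm b f := by
    have h := stub_localizedCut_energy_window hf hbB hsupp
    unfold weilClosedForm
    linarith
  have hsub : weilPrimeIndex b ⊆ weilPrimeIndex B :=
    fun _ hn ↦ mem_weilPrimeIndex.2 ((mem_weilPrimeIndex.1 hn).trans_le (by linarith))
  have hshift : ∑ n ∈ weilPrimeIndex b, (w n - zetaTable n) *
        (weilIncrement f (Real.log n) - 2 * ∫ x, ‖f x‖ ^ 2) =
      ∑ n ∈ weilPrimeIndex B, (w n - zetaTable n) *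
        (weilIncrement f (Real.log n) - 2 * ∫ x, ‖f x‖ ^ 2) := by
    refine Finset.sum_subset hsub fun n _ hn ↦ ?_
    have hn' : 2 * b ≤ Real.log n := not_lt.1 fun h ↦ hn (mem_weilPrimeIndex.2 h)
    rw [stub_localizedCut_weilIncrement_eq_two_mul hf hsupp hn', sub_self, mul_zero]
  rw [tableClosedForm_eq_weilClosedForm_add, tableClosedForm_eq_weilClosedForm_add, hζ, hshift]

/-- The prime term of the table `w` through increments: for a test function `g` supported in
`[-a, a]`, `Σₙ w(n)(k(log n) + k(−log n)) = Σ_{log n < 2a} w(n)(2‖g‖² − D_{log n}(g))`, `k = g ⋆ g̃`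
(as the tree's `weilPrimeTerm_weilConv_weilReflect` for ζ's table). [cite: Bombieri2000Weil, Thm 2 (p. 193), prime term] -/
theorem tableDatum_primeTerm_weilConv_weilReflect (w : ℕ → ℝ) {g : ℝ → ℂ} (hg : IsWeilTest g)
    {a : ℝ} (hsupp : tsupport g ⊆ Icc (-a) a) :
    (tableDatum w).primeTerm (weilConv g (weilReflect g)) =
      ((∑ n ∈ weilPrimeIndex a, w n *
        (2 * (∫ x : ℝ, ‖g x‖ ^ 2) - weilIncrement g (Real.log n)) : ℝ) : ℂ) := by
  have hvan : ∀ n ∉ weilPrimeIndex a,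
      ((w n : ℝ) : ℂ) * (weilConv g (weilReflect g) (Real.log n) +
        weilConv g (weilReflect g) (-Real.log n)) = 0 := by
    intro n hn
    rw [mem_weilPrimeIndex, not_lt] at hn
    have h0 : 0 ≤ Real.log n := Real.log_natCast_nonneg n
    have h1 : weilConv g (weilReflect g) (Real.log n) = 0 :=
      weilConv_weilReflect_eq_zero_of_le_abs hg hsupp (by rwa [abs_of_nonneg h0])
    have h2 : weilConv g (weilReflect g) (-Real.log n) = 0 :=
      weilConv_weilReflect_eq_zero_of_le_abs hg hsupp (by rwa [abs_neg, abs_of_nonneg h0])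
    rw [h1, h2, add_zero, mul_zero]
  unfold ExplicitDatum.primeTerm
  simp only [tableDatum]
  rw [tsum_eq_sum hvan]
  push_cast
  refine Finset.sum_congr rfl fun n _ ↦ ?_
  rw [weilConv_weilReflect_add_neg hg]
  push_cast
  ring

/-- **On window tests the closed form of a table IS its Weil quadratic form**: for a test function
`g` supported in `[-a, a]`, `tableClosedForm a w g = Re Q_{tableDatum w}(g)` (ζ's case is the tree's
`weilClosedForm_eq_re_weilQuadratic`). [cite: Bombieri2000Weil, Thm 2 (p. 193)] -/
theorem tableClosedForm_eq_re_quadratic (w : ℕ → ℝ) {g : ℝ → ℂ} (hg : IsWeilTest g) {a : ℝ}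
    (hsupp : tsupport g ⊆ Icc (-a) a) :
    tableClosedForm a w g = ((tableDatum w).quadratic g).re := by
  have hdiff : (tableDatum w).quadratic g = (tableDatum zetaTable).quadratic g +
      ((tableDatum zetaTable).primeTerm (weilConv g (weilReflect g)) -
        (tableDatum w).primeTerm (weilConv g (weilReflect g))) := by
    unfold ExplicitDatum.quadratic ExplicitDatum.functional
    rw [tableDatum_smooth w zetaTable]
    ring
  rw [hdiff, tableDatum_zetaTable_quadratic, tableDatum_primeTerm_weilConv_weilReflect w hg hsupp,
    tableDatum_primeTerm_weilConv_weilReflect zetaTable hg hsupp, Complex.add_re, Complex.sub_re,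
    Complex.ofReal_re, Complex.ofReal_re, ← weilClosedForm_eq_re_weilQuadratic hg hsupp,
    tableClosedForm_eq_weilClosedForm_add, sum_sub_mul_sub]
  have e1 : ∀ u : ℕ → ℝ, ∑ n ∈ weilPrimeIndex a, u n *
      (2 * (∫ x : ℝ, ‖g x‖ ^ 2) - weilIncrement g (Real.log n)) =
      2 * (∫ x : ℝ, ‖g x‖ ^ 2) * (∑ n ∈ weilPrimeIndex a, u n) -
        ∑ n ∈ weilPrimeIndex a, u n * weilIncrement g (Real.log n) := by
    intro u
    rw [Finset.mul_sum, ← Finset.sum_sub_distrib]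
    exact Finset.sum_congr rfl fun n _ ↦ by ring
  rw [e1, e1]
  ring

end Summit.RiemannHypothesis.RiemannHypothesis.Theorems.PfPersistence

end
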